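/- Free-seat work of EXTRA WIDTH SEAT `ym-line-cbag-p1-w5` (prover-ym-line-cbag-p1-w5-g8-0), route `EguchiKawaiDirectionLadder`
(ideator ym-idea-2, LINE 8): post-closure glue for the barrier entry `EguchiKawaiBreakdown` (crux stmt-QuantumFields-27724,
CLOSED·proved).  One-line compositions of LANDED theorems: `EguchiKawaiBreakdown_holds` (LEAD g24, breaking for `d ≥ 3`),
`ek_centreSymmetry_transition` (LEAD g26, strong-coupling symmetry and the transition for `d ≥ 3`) and
`ekOpenLinesVanish_of_le_two` (`…TwoDimSymmetric.lean`, symmetry at EVERY coupling for `d ≤ 2`).  HONEST FRAMING: a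
statement about the single-site Eguchi–Kawai model; nothing here bears on the Yang–Mills mass gap (no summit statement, no
continuum limit, no large-`N` reduction of the `d`-dimensional lattice theory is proved or advanced). -/
import Summits.QuantumFields.YangMills.Theorems.EguchiKawaiDirectionLadderCentreSymmetryTransition
import Summits.QuantumFields.YangMills.Theorems.EguchiKawaiDirectionLadderTwoDimSymmetric
import HarnessLib

/-!
# Route `EguchiKawaiDirectionLadder`: the dimension threshold of the Eguchi–Kawai breakdown is exactly `3`

* `weakCouplingBreakdown_iff_three_le` — the conclusion of the barrier fact `EguchiKawaiBreakdown` for a given `d` (at all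
  sufficiently weak couplings the open-line order parameter `⟨|(1/N) tr U_μ|²⟩_EK` fails to tend to zero in some direction)
  holds IF AND ONLY IF `3 ≤ d`;
* `not_ekOpenLinesVanish_iff_three_le` (and `…SU…`) — equivalently, the naive reduction's standing hypothesis
  `EKOpenLinesVanish d b` fails throughout the weak-coupling regime iff `3 ≤ d`; for `d ≤ 2` it holds at EVERY coupling;
* `ek_dimension_dichotomy` — the complete picture by dimension: EITHER `d ≤ 2` and the model is centre symmetric at every
  real coupling, OR `d ≥ 3` and there is a transition `0 < b₁ ≤ b₀` (symmetric for `|b| < b₁`, broken for `b > b₀`;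
  `ek_centreSymmetry_transition`, LEAD g26).  The window `[b₁, b₀]` for `d ≥ 3` is the genuinely open part.

`⇐` is `EguchiKawaiBreakdown_holds` (LINE 8: Bhanot–Heller–Neuberger breaking for `d ≥ 3`, Makeenko §14.5 (14.77)); `⇒` is
the `d = 2` centre symmetry of `EguchiKawaiDirectionLadderTwoDimSymmetric.lean` (Makeenko §14.4: the reduction "is valid,
strictly speaking, only in `d = 2`").  So the printed dichotomy "`d > 2` broken / `d = 2` valid" is now a theorem of the tree
in both directions, for the order parameter of the barrier entry.
-/

set_option autoImplicit false

open Filter Topology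
open Literature.Barriers.QuantumFields

namespace Summit.QuantumFields.YangMills.Theorems.EguchiKawaiDirectionLadder

/-- **The dimension threshold of the Eguchi–Kawai breakdown is exactly `3`.**  The conclusion of the barrier fact
`EguchiKawaiBreakdown` for a given `d` — at all sufficiently weak couplings the open-line order parameter fails to tend to
zero in some direction — holds if and only if `d ≥ 3` (`⇐`: `EguchiKawaiBreakdown_holds`, LINE 8; `⇒`: `d ≤ 2` is centre
symmetric at every coupling, `ekOpenLinesVanish_of_le_two`). -/
theorem weakCouplingBreakdown_iff_three_le (d : ℕ) :
    (∃ b₀ : ℝ, 0 ≤ b₀ ∧ ∀ b : ℝ, b₀ < b →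
        ∃ μ : Fin d, ¬ Tendsto (fun N : ℕ => ekOrderParameter d N b μ) atTop (𝓝 0)) ↔ 3 ≤ d := by
  constructor
  · rintro ⟨b₀, -, h⟩
    by_contra hd
    push Not at hd
    obtain ⟨μ, hμ⟩ := h (b₀ + 1) (by linarith)
    exact hμ (ekOpenLinesVanish_of_le_two (by omega) (b₀ + 1) μ)
  · exact fun hd => EguchiKawaiBreakdown_holds d hd

/-- **Equivalently, in terms of the technique-class hypothesis**: the naive reduction's standing hypothesis
`EKOpenLinesVanish d b` fails throughout the weak-coupling regime if and only if `d ≥ 3`; for `d ≤ 2` it holds at every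
coupling. -/
theorem not_ekOpenLinesVanish_iff_three_le (d : ℕ) :
    (∃ b₀ : ℝ, 0 ≤ b₀ ∧ ∀ b : ℝ, b₀ < b → ¬ EKOpenLinesVanish d b) ↔ 3 ≤ d := by
  constructor
  · rintro ⟨b₀, -, h⟩
    by_contra hd
    push Not at hd
    exact h (b₀ + 1) (by linarith) (ekOpenLinesVanish_of_le_two (by omega) (b₀ + 1))
  · exact fun hd => EguchiKawaiBreakdown_holds.not_ekOpenLinesVanish hd

/-- The same dichotomy for the gauge group `SU(N)` (`ekOpenLinesVanishSU_iff`). -/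
theorem not_ekOpenLinesVanishSU_iff_three_le (d : ℕ) :
    (∃ b₀ : ℝ, 0 ≤ b₀ ∧ ∀ b : ℝ, b₀ < b → ¬ EKOpenLinesVanishSU d b) ↔ 3 ≤ d := by
  simp only [ekOpenLinesVanishSU_iff]
  exact not_ekOpenLinesVanish_iff_three_le d

/-- **The centre symmetry of the naive Eguchi–Kawai model, by dimension.**  EITHER `d ≤ 2` and the open-line order
parameter tends to zero at EVERY real coupling (`ekOpenLinesVanish_of_le_two`), OR `d ≥ 3` and there is a transition: couplings
`0 < b₁ ≤ b₀` with the symmetry unbroken for `|b| < b₁` and broken for `b > b₀` (`ek_centreSymmetry_transition`; what happens on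
`[b₁, b₀]` is not decided here). -/
theorem ek_dimension_dichotomy (d : ℕ) :
    (d ≤ 2 ∧ ∀ b : ℝ, EKOpenLinesVanish d b) ∨
      (3 ≤ d ∧ ∃ b₁ b₀ : ℝ, 0 < b₁ ∧ b₁ ≤ b₀ ∧ (∀ b : ℝ, |b| < b₁ → EKOpenLinesVanish d b) ∧
        (∀ b : ℝ, b₀ < b → ¬ EKOpenLinesVanish d b)) := by
  rcases Nat.lt_or_ge 2 d with hd | hd
  · exact Or.inr ⟨by omega, ek_centreSymmetry_transition (by omega)⟩
  · exact Or.inl ⟨hd, fun b => ekOpenLinesVanish_of_le_two hd b⟩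

end Summit.QuantumFields.YangMills.Theorems.EguchiKawaiDirectionLadder
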